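import Literature.NumberTheory.EllipticCurves.IwasawaSelmer
import Literature.NumberTheory.EllipticCurves.HasseWeilAbelian
import Mathlib.NumberTheory.Padics.HeightOneSpectrum
import HarnessLib

/-!
# Greenberg–Vatsal, *On the Iwasawa invariants of elliptic curves* (Invent. Math. 142 (2000)),
# §1 pp. 6–8 and §2 Prop. (2.4): the NON-PRIMITIVE Selmer group `Sel^{Σ₀}_E(ℚ_∞)_p`, the local
# invariants `s_ℓ`, `d_ℓ`, `δ_E^{(ℓ)} = s_ℓ d_ℓ`, and the `Λ`-module `X^{Σ₀} = Hom(Sel^{Σ₀}, ℚ_p/ℤ_p)`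
# (DEFINITIONS ONLY — every `def` has a body; nothing is asserted)

HONEST FRAMING (BSD rank-`≤ 1` residual cell `b2b-bsdres`, home
`run/shared/lean/b2b/bsd-rank1-residual/`, unit `b2b-bsdres-eisenstein-p2`): the cell deletes the
COMBINATION-SHAPED residual classes of the rank-`≤ 1` BSD formula from PUBLISHED theorems only and
TYPES the construction-shaped ones; this is not "finishing BSD". This file only NAMES, in the tree's
vocabulary, four objects PRINTED in Greenberg–Vatsal 2000 that the cell's route G
(`Summits/BirchSwinnertonDyer/Rank1Residual/X1/CongruenceTransfer.lean`, typed input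
`CongruentLambdaShift`; `…/X2/CongruenceTransfer*.lean`) quantifies over:

* `nonPrimitiveSelmerGroupOver W p H Σ₀` / `nonPrimitiveSelmerInfty W κ Σ₀` — GV's
  **non-primitive Selmer group** `Sel^{Σ₀}_E(ℚ_∞)_p`: the classical `p^∞`-Selmer group of `E` over
  `L = K̄^H` (`WeierstrassCurve.selmerGroupOver`, file `SubgroupSelmer`: Kummer conditions at every
  place of `L`) with the local conditions at the places above the finite set `Σ₀` OMITTED
  (GV p. 7, display before (5));
* `sFactor p ℓ = s_ℓ` — "the largest power of `p` dividing `(ℓ^{p-1} - 1)/p`" = the number of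
  primes of `ℚ_∞` above `ℓ` (GV Prop. (2.4), p. 22; p. 30);
* `dMultiplicity W p v = d_ℓ` — "the multiplicity of `X = ℓ̃^{-1}` as a root of `P̃_ℓ(X) ∈ k[X]`",
  `P_ℓ(X) = det((1 - Frob_ℓ X) | (V_p)_{I_ℓ})` (GV Prop. (2.4)); for `V_p = V_p(E)` this `P_ℓ` is
  the Euler factor of `E` at `ℓ` (GV p. 8: "`P_ℓ(E/ℚ, X) = (1 - α_ℓ X)(1 - β_ℓ X)` for the usual
  quantities"; in the tree this identification `det(1 - σ T | (V_p E)_{I_𝔓}) = L_v(E, T)` is the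
  THEOREM `WeierstrassCurve.reverse_charpoly_toInertiaCoinvariants_eq_localPolynomialAt`, file
  `HasseWeilAbelianEulerFactorForallProofs`), so `P_ℓ = W.localPolynomialAt v` (Mathlib's local
  polynomial `1 - a_ℓ T + ℓ T²`, `1 ∓ T`, `1` by reduction type, file `HasseWeilAbelian`);
* `delta W p v = δ_E^{(ℓ)} = s_ℓ · d_ℓ` — the `λ`-invariant of `𝓗_ℓ(ℚ_∞)^` (GV p. 7: "It turns out
  in fact that `𝓗_ℓ(ℚ_∞) ≅ (ℚ_p/ℤ_p)^{δ_E^{(ℓ)}}`, where `δ_E^{(ℓ)}` is a non-negative integer which is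
  easily determined from the Euler factor for `ℓ` in `L(E/ℚ, s)`"; Prop. (2.4): "Its `λ`-invariant
  is equal to `s_ℓ d_ℓ`");
* `NonPrimitiveDualData W κ γ Σ₀` — the hypothesis structure "`X^{Σ₀}` is a Pontryagin dual of
  `Sel^{Σ₀}_E(K_∞)_p` with its `Λ = ℤ_p⟦T⟧`-action, `T = γ - 1`", word for word the tree's
  `WeierstrassCurve.SelmerDualData` (file `IwasawaSelmer`) with `Sel` replaced by `Sel^{Σ₀}`
  (GV p. 7: "the characteristic polynomial of the `Λ`-module `Sel^{Σ₀}_E(ℚ_∞)_p^`", p. 17: "discrete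
  `O`-modules with a natural action of `Γ = Gal(ℚ_∞/ℚ)`. Regarding them as `Λ`-modules … they are
  known to be cofinitely generated").

Two sibling files record the two PRINTED statements about these objects that route G consumes as
named facts: `NonPrimitiveLambdaInvariant` (GV (7): `λ_{E,Σ₀} = λ_E + Σ_{ℓ∈Σ₀} δ_E^{(ℓ)}`) and
`NonPrimitiveSelmerDivisible` (GV p. 8 / Prop. (2.8): "`Sel^{Σ₀}_E(ℚ_∞)_p` is a divisible group" when
`μ_E = 0` and `Σ₀ ⊇` the bad primes). The kernel consequences (`#Sel^{Σ₀}[p] = p^{λ_E + Σ δ}`,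
`Sel^{Σ₀} = S^{Σ₀}_{E[p^∞]}(ℚ_∞)` of GV p. 26, and the derivation of `CongruentLambdaShift` from
`E₁[p] ≅ E₂[p]`) are THEOREMS under `Summits/BirchSwinnertonDyer/Rank1Residual/X2/`.

## Citation header (read by this seat on the held text arXiv:math/9906215 =
## `paper:arxiv-math_9906215`, dvips stream decoded by the cell, `b2b-bsdres-lit/u1/gv2000_decoded.txt`;
## page numbers of the arXiv typescript)

* GV §1 p. 6–7: "For each finite prime `ℓ ∈ Σ`, the group `𝓗_ℓ(ℚ_∞)` is defined by
  `𝓗_ℓ(ℚ_∞) = ∏_{η∣ℓ} H¹((ℚ_∞)_η, E[p^∞])/im(κ_η)`. Here `η` runs over the finite set of places of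
  `ℚ_∞` over `ℓ` … If `ℓ = ∞` and `p` is odd, then we simply take `𝓗_ℓ(ℚ_∞) = 0`. … Let `Σ₀` be any
  subset of `Σ` which does not contain `p`. We define the corresponding "non-primitive" Selmer group
  by `Sel^{Σ₀}_E(ℚ_∞)_p = ker( H¹(ℚ_Σ/ℚ_∞, E[p^∞]) → ∏_{ℓ ∈ Σ − Σ₀} 𝓗_ℓ(ℚ_∞) )`."
* GV §2 Prop. (2.4), p. 22: "Let `P_ℓ(X) = det((1 - Frob_ℓ X)|(V_p)_{I_ℓ}) ∈ O[X]`. … The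
  characteristic ideal of the `Λ`-module `𝓗_ℓ(ℚ_∞)^` is generated by `𝒫_ℓ`. Its `μ`-invariant is
  zero. Its `λ`-invariant is equal to `s_ℓ d_ℓ`. Here `s_ℓ` is the largest power of `p` dividing
  `(ℓ^{p-1} - 1)/p` and `d_ℓ` is the multiplicity of `X = ℓ̃^{-1}` as a root of `P̃_ℓ(X) ∈ k[X]`,
  where `k` is the residue field of `O`, and the `~` means reduction modulo `𝔪`."
* GV §2 p. 30: "for any prime `l ≠ p`, `s_l` denotes the number of primes of `ℚ_∞` lying above `l`";
  p. 27 (worked example, `p = 5`, `ℓ = 7`): "`5² ∥ (7⁴ - 1)` and so `s_7 = 5`".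

## Design notes

* `nonPrimitiveSelmerGroupOver` is LITERALLY `WeierstrassCurve.selmerGroupOver` (file
  `SubgroupSelmer`) with the finite places restricted to `v ∉ Σ₀`; `Σ₀ = ∅` gives it back
  (`nonPrimitiveSelmerGroupOver_empty`), it is monotone in `Σ₀`, contains `Sel`, and
  `Sel = Sel^{Σ₀} ⊓ (conditions above Σ₀)` (`selmerGroupOver_eq_nonPrimitive_inf`, GV's inclusion
  `Sel_E ⊆ Sel^{Σ₀}_E` before (5)). GV restrict to classes unramified outside
  `Σ ⊇ Σ₀ ∪ {p, ∞, bad}`; the Kummer condition at a good `v ∉ Σ`, `v ∤ p` IS "unramified", so no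
  `Σ` appears here (the conditions are imposed at every place not above `Σ₀`); the archimedean
  conditions are kept and are vacuous for odd `p` (GV: "`𝓗_∞(ℚ_∞) = 0`"; kernel:
  `Summits/…/X2/GreenbergVatsalSelmerEquality.localKerOver_completion_eq_top_of_odd`).
  -- TODO(general form): GV allow `Σ₀ ∋ ∞` for `p = 2` ("a more careful definition would be
  -- necessary if `p = 2`"); not transcribed.
* `d_ℓ` is read off Mathlib's `W.localPolynomialAt v ∈ ℤ[T]` reduced mod `p`, at `T = ℓ̃⁻¹ ∈ 𝔽_p`
  (`ℓ = Rat.HeightOneSpectrum.natGenerator v`, meaningful for `ℓ ≠ p`).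
* Conjugation-stability of `Sel^{Σ₀}` (`conjH1_mem_nonPrimitiveSelmerGroupOver`) is PROVED here (as
  `map_conjH1_selmerGroupOver_le_holds` in `IwasawaSelmerProofs`), so that the field `conj_mem` of
  `NonPrimitiveDualData` is dischargeable; existence of the datum (`Nonempty`) is proved in the cell's
  Summits file, exactly as `WeierstrassCurve.nonempty_selmerDualData_holds`.
-/

noncomputable section

open scoped Classical

open NumberField IsDedekindDomain Field WeierstrassCurve Polynomial

universe u

namespace Literature.NumberTheory.EllipticCurves.GreenbergVatsal2000

/-! ## §1. The non-primitive Selmer group `Sel^{Σ₀}_E(L)_p` over `L = K̄^H` -/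

section NonPrimitive

variable {K : Type u} [Field K] [NumberField K] (W : WeierstrassCurve K) (p : ℕ)
  (H : Subgroup (absoluteGaloisGroup K)) [H.Normal] (S₀ : Set (HeightOneSpectrum (𝓞 K)))

/-- **Greenberg–Vatsal's non-primitive Selmer group `Sel^{Σ₀}_E(L)_p ⊆ H¹(H, E[p^∞])`** over
`L = K̄^H` (intended: `H = Gal(K̄/K_∞)`): the classes `c` such that `conj_σ c` dies in
`H¹(H_{K_v}, E(K̄_v))` for every finite place `v ∉ Σ₀`, every infinite place, and every `σ ∈ Γ_K`
— the classical Selmer group `WeierstrassCurve.selmerGroupOver` with the Kummer conditions at the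
places above `Σ₀` omitted: "`Sel^{Σ₀}_E(ℚ_∞)_p = ker( H¹(ℚ_Σ/ℚ_∞, E[p^∞]) → ∏_{ℓ∈Σ−Σ₀} 𝓗_ℓ(ℚ_∞) )`".
[cite: GreenbergVatsal2000, §1 p. 7 (definition of the non-primitive Selmer group)] -/
def nonPrimitiveSelmerGroupOver : AddSubgroup (W.subgroupH1 p H) :=
  (⨅ (v : HeightOneSpectrum (𝓞 K)) (_ : v ∉ S₀) (σ : absoluteGaloisGroup K),
      (W.localKerOver p H (v.adicCompletion K)).comap (W.conjH1 p H σ)) ⊓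
    ⨅ (w : InfinitePlace K) (σ : absoluteGaloisGroup K),
      (W.localKerOver p H w.Completion).comap (W.conjH1 p H σ)

variable {W p H S₀} in
/-- Membership in `Sel^{Σ₀}_E(L)_p`. [cite: GreenbergVatsal2000, §1 p. 7] -/
theorem mem_nonPrimitiveSelmerGroupOver_iff (c : W.subgroupH1 p H) :
    c ∈ nonPrimitiveSelmerGroupOver W p H S₀ ↔
      (∀ (v : HeightOneSpectrum (𝓞 K)), v ∉ S₀ → ∀ σ : absoluteGaloisGroup K,
          W.conjH1 p H σ c ∈ W.localKerOver p H (v.adicCompletion K)) ∧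
        ∀ (w : InfinitePlace K) (σ : absoluteGaloisGroup K),
          W.conjH1 p H σ c ∈ W.localKerOver p H w.Completion := by
  simp only [nonPrimitiveSelmerGroupOver, AddSubgroup.mem_inf, AddSubgroup.mem_iInf,
    AddSubgroup.mem_comap]

/-- `Sel_E(L)_p ⊆ Sel^{Σ₀}_E(L)_p` (GV p. 7, before (5): dropping conditions enlarges the group).
[cite: GreenbergVatsal2000, §1 p. 7] -/
theorem selmerGroupOver_le_nonPrimitiveSelmerGroupOver :
    W.selmerGroupOver p H ≤ nonPrimitiveSelmerGroupOver W p H S₀ := by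
  intro c hc
  rw [WeierstrassCurve.mem_selmerGroupOver_iff] at hc
  rw [mem_nonPrimitiveSelmerGroupOver_iff]
  exact ⟨fun v _ σ ↦ hc.1 v σ, hc.2⟩

/-- `Sel^{Σ₀}` is monotone in `Σ₀`. [cite: GreenbergVatsal2000, §1 p. 7] -/
theorem nonPrimitiveSelmerGroupOver_mono {S₀ S₁ : Set (HeightOneSpectrum (𝓞 K))} (h : S₀ ⊆ S₁) :
    nonPrimitiveSelmerGroupOver W p H S₀ ≤ nonPrimitiveSelmerGroupOver W p H S₁ := by
  intro c hc
  rw [mem_nonPrimitiveSelmerGroupOver_iff] at hc ⊢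
  exact ⟨fun v hv σ ↦ hc.1 v (fun hv' ↦ hv (h hv')) σ, hc.2⟩

/-- `Sel^{∅}_E(L)_p = Sel_E(L)_p`. [cite: GreenbergVatsal2000, §1 p. 7] -/
theorem nonPrimitiveSelmerGroupOver_empty :
    nonPrimitiveSelmerGroupOver W p H ∅ = W.selmerGroupOver p H := by
  ext c
  rw [mem_nonPrimitiveSelmerGroupOver_iff, WeierstrassCurve.mem_selmerGroupOver_iff]
  exact ⟨fun h ↦ ⟨fun v σ ↦ h.1 v (Set.notMem_empty v) σ, h.2⟩, fun h ↦ ⟨fun v _ σ ↦ h.1 v σ, h.2⟩⟩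

/-- **`Sel_E(L)_p = Sel^{Σ₀}_E(L)_p ⊓ (Kummer conditions above Σ₀)`**: the primitive Selmer group is
cut out of the non-primitive one by the omitted local conditions — the exactness of
`0 → Sel_E → Sel^{Σ₀}_E → ∏_{ℓ∈Σ₀} 𝓗_ℓ` at the first two places (GV (5), p. 7).
[cite: GreenbergVatsal2000, §1 p. 7 (display (5))] -/
theorem selmerGroupOver_eq_nonPrimitive_inf :
    W.selmerGroupOver p H =
      nonPrimitiveSelmerGroupOver W p H S₀ ⊓
        ⨅ (v : HeightOneSpectrum (𝓞 K)) (_ : v ∈ S₀) (σ : absoluteGaloisGroup K),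
          (W.localKerOver p H (v.adicCompletion K)).comap (W.conjH1 p H σ) := by
  ext c
  rw [AddSubgroup.mem_inf, WeierstrassCurve.mem_selmerGroupOver_iff,
    mem_nonPrimitiveSelmerGroupOver_iff]
  simp only [AddSubgroup.mem_iInf, AddSubgroup.mem_comap]
  constructor
  · exact fun h ↦ ⟨⟨fun v _ σ ↦ h.1 v σ, h.2⟩, fun v _ σ ↦ h.1 v σ⟩
  · rintro ⟨⟨h1, h2⟩, h3⟩
    refine ⟨fun v σ ↦ ?_, h2⟩
    by_cases hv : v ∈ S₀
    · exact h3 v hv σ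
    · exact h1 v hv σ

/-- **`Sel^{Σ₀}_E(L)_p` is stable under the conjugation action of `Γ_K`** (the set of local
conditions is permuted: `conj_σ ∘ conj_γ = conj_{σγ}`, `conjH1_mul`), so that for `L = K_∞` it is a
`Λ`-submodule of `H¹(K_∞, E[p^∞])` (GV p. 17: "discrete `O`-modules with a natural action of
`Γ = Gal(ℚ_∞/ℚ)`"). [cite: GreenbergVatsal2000, §2 p. 17] -/
theorem conjH1_mem_nonPrimitiveSelmerGroupOver (γ : absoluteGaloisGroup K)
    {c : W.subgroupH1 p H} (hc : c ∈ nonPrimitiveSelmerGroupOver W p H S₀) :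
    W.conjH1 p H γ c ∈ nonPrimitiveSelmerGroupOver W p H S₀ := by
  rw [mem_nonPrimitiveSelmerGroupOver_iff] at hc ⊢
  have hmul : ∀ σ, W.conjH1 p H σ (W.conjH1 p H γ c) = W.conjH1 p H (σ * γ) c := fun σ ↦ by
    rw [W.conjH1_mul_holds p H σ γ, AddMonoidHom.comp_apply]
  exact ⟨fun v hv σ ↦ by rw [hmul]; exact hc.1 v hv (σ * γ),
    fun w σ ↦ by rw [hmul]; exact hc.2 w (σ * γ)⟩

end NonPrimitive

/-! ## §2. Over the top of a `ℤ_p`-extension: `Sel^{Σ₀}_E(K_∞)_p` -/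

section Tower

variable {K : Type u} [Field K] [NumberField K] (W : WeierstrassCurve K) {p : ℕ} [Fact p.Prime]
  (κ : ZpExtension K p) (S₀ : Set (HeightOneSpectrum (𝓞 K)))

/-- **`Sel^{Σ₀}_E(K_∞)_p ⊆ H¹(K_∞, E[p^∞]) = H¹(ker κ, E[p^∞])`**: the non-primitive Selmer group over
the top of the `ℤ_p`-extension `κ` (for `K = ℚ`, `κ` cyclotomic: GV's `Sel^{Σ₀}_E(ℚ_∞)_p`).
[cite: GreenbergVatsal2000, §1 p. 7] -/
def nonPrimitiveSelmerInfty : AddSubgroup (W.subgroupH1 p κ.kerSubgroup) :=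
  nonPrimitiveSelmerGroupOver W p κ.kerSubgroup S₀

/-- Unfolding (definitional). [cite: GreenbergVatsal2000, §1 p. 7] -/
theorem nonPrimitiveSelmerInfty_eq :
    nonPrimitiveSelmerInfty W κ S₀ = nonPrimitiveSelmerGroupOver W p κ.kerSubgroup S₀ :=
  rfl

/-- `Sel_{p^∞}(E/K_∞) ⊆ Sel^{Σ₀}_E(K_∞)_p` (`WeierstrassCurve.selmerInfty`, file `IwasawaSelmer`).
[cite: GreenbergVatsal2000, §1 p. 7] -/
theorem selmerInfty_le_nonPrimitiveSelmerInfty :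
    W.selmerInfty κ ≤ nonPrimitiveSelmerInfty W κ S₀ :=
  selmerGroupOver_le_nonPrimitiveSelmerGroupOver W p κ.kerSubgroup S₀

/-- `Sel_{p^∞}(E/K_∞) = Sel^{Σ₀}_E(K_∞)_p ⊓ (Kummer conditions above Σ₀)` (GV (5) at the first two
places). [cite: GreenbergVatsal2000, §1 p. 7 (display (5))] -/
theorem selmerInfty_eq_nonPrimitiveSelmerInfty_inf :
    W.selmerInfty κ =
      nonPrimitiveSelmerInfty W κ S₀ ⊓
        ⨅ (v : HeightOneSpectrum (𝓞 K)) (_ : v ∈ S₀) (σ : absoluteGaloisGroup K),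
          (W.localKerOver p κ.kerSubgroup (v.adicCompletion K)).comap
            (W.conjH1 p κ.kerSubgroup σ) :=
  selmerGroupOver_eq_nonPrimitive_inf W p κ.kerSubgroup S₀

/-- `Sel^{Σ₀}_E(K_∞)_p` is stable under `conj_γ` for every `γ ∈ Γ_K`.
[cite: GreenbergVatsal2000, §2 p. 17] -/
theorem conjH1_mem_nonPrimitiveSelmerInfty (γ : absoluteGaloisGroup K)
    {c : W.subgroupH1 p κ.kerSubgroup} (hc : c ∈ nonPrimitiveSelmerInfty W κ S₀) :
    W.conjH1 p κ.kerSubgroup γ c ∈ nonPrimitiveSelmerInfty W κ S₀ :=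
  conjH1_mem_nonPrimitiveSelmerGroupOver W p κ.kerSubgroup S₀ γ hc

end Tower

/-! ## §3. The local invariants `s_ℓ`, `d_ℓ`, `δ_E^{(ℓ)} = s_ℓ d_ℓ` of GV Prop. (2.4) -/

section LocalInvariants

/-- **`s_ℓ`** — "the largest power of `p` dividing `(ℓ^{p-1} - 1)/p`", equivalently the number of
primes of `ℚ_∞` lying above the prime `ℓ ≠ p` (GV p. 30; e.g. `5² ∥ 7⁴ - 1` "and so `s_7 = 5`",
p. 27): `p ^ (v_p(ℓ^{p-1} - 1) - 1)`. Junk for `ℓ = p`.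
NB (referee nit `GV-sFactor-p30-valuation-wording`): GV p. 30 reads "for any prime `l ≠ p`, `s_l`
denotes the number of primes of `ℚ_∞` lying above `l`, or equivalently the `p`-adic valuation of
`(l^{p-1} - 1)/p`" — loose wording for "`p` to the power that valuation": the number of primes of
`ℚ_∞` above `ℓ` IS `p^{v_p((ℓ^{p-1}-1)/p)}`, which is Prop. (2.4)'s "largest power of `p` dividing
`(ℓ^{p-1} - 1)/p`" and is what the worked example (`5² ∥ 7⁴ - 1`, `s_7 = 5`, not `1`) confirms; this
definition follows Prop. (2.4) and the example.
[cite: GreenbergVatsal2000, §2 Prop. (2.4) (p. 22) and p. 30] -/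
def sFactor (p ℓ : ℕ) : ℕ :=
  p ^ (padicValNat p (ℓ ^ (p - 1) - 1) - 1)

variable {K : Type u} [Field K] [NumberField K]

/-- **`P̃_ℓ(X) ∈ 𝔽_p[X]`**: the Euler factor `P_ℓ(X) = det((1 - Frob_ℓ X)|(V_p E)_{I_ℓ})` of `E` at the
finite place `v` (for an elliptic curve this determinant IS Mathlib's local polynomial
`W.localPolynomialAt v = 1 - a_v T + q_v T², 1 - T, 1 + T, 1` — tree theorem
`WeierstrassCurve.reverse_charpoly_toInertiaCoinvariants_eq_localPolynomialAt`; GV p. 8: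
"`P_ℓ(E/ℚ, X) = (1 - α_ℓ X)(1 - β_ℓ X)` for the usual quantities `α_ℓ`, `β_ℓ`"), reduced modulo `p`.
[cite: GreenbergVatsal2000, §2 Prop. (2.4) (p. 22) and §1 p. 8] -/
def eulerFactorModP (W : WeierstrassCurve K) (p : ℕ) (v : HeightOneSpectrum (𝓞 K)) :
    (ZMod p)[X] :=
  (W.localPolynomialAt v).map (Int.castRingHom (ZMod p))

/-- **`d_ℓ`** — "the multiplicity of `X = ℓ̃^{-1}` as a root of `P̃_ℓ(X) ∈ k[X]`" (`k = 𝔽_p` for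
`O = ℤ_p`), for an elliptic curve `E` over `ℚ` at the finite place `v = (ℓ)`, `ℓ = Rat.HeightOneSpectrum.natGenerator v`
(meaningful for `ℓ ≠ p`). [cite: GreenbergVatsal2000, §2 Prop. (2.4) (p. 22)] -/
def dMultiplicity (W : WeierstrassCurve ℚ) (p : ℕ) (v : HeightOneSpectrum (𝓞 ℚ)) : ℕ :=
  (eulerFactorModP W p v).rootMultiplicity ((Rat.HeightOneSpectrum.natGenerator v : ZMod p)⁻¹)

/-- **`δ_E^{(ℓ)} = s_ℓ · d_ℓ`** — the `λ`-invariant of the `Λ`-module `𝓗_ℓ(ℚ_∞)^`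
("`𝓗_ℓ(ℚ_∞) ≅ (ℚ_p/ℤ_p)^{δ_E^{(ℓ)}}`", GV p. 7; "Its `λ`-invariant is equal to `s_ℓ d_ℓ`", Prop. (2.4)),
for `E/ℚ` at the finite place `v = (ℓ)`, `ℓ ≠ p`.
[cite: GreenbergVatsal2000, §2 Prop. (2.4) (p. 22) and §1 p. 7] -/
def delta (W : WeierstrassCurve ℚ) (p : ℕ) (v : HeightOneSpectrum (𝓞 ℚ)) : ℕ :=
  sFactor p (Rat.HeightOneSpectrum.natGenerator v) * dMultiplicity W p v

/-- Unfolding `delta` (definitional). [cite: GreenbergVatsal2000, §2 Prop. (2.4) (p. 22)] -/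
theorem delta_eq (W : WeierstrassCurve ℚ) (p : ℕ) (v : HeightOneSpectrum (𝓞 ℚ)) :
    delta W p v = sFactor p (Rat.HeightOneSpectrum.natGenerator v) * dMultiplicity W p v :=
  rfl

end LocalInvariants

/-! ## §4. The `Λ`-module `X^{Σ₀} = Hom(Sel^{Σ₀}_E(K_∞)_p, ℚ_p/ℤ_p)` (hypothesis structure) -/

section Dual

variable {K : Type u} [Field K] [NumberField K] (W : WeierstrassCurve K) {p : ℕ} [Fact p.Prime]
  (κ : ZpExtension K p) (γ : absoluteGaloisGroup K) (S₀ : Set (HeightOneSpectrum (𝓞 K)))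

/-- **Pontryagin-dual data for the non-primitive Selmer group**: a `Λ = ℤ_p⟦T⟧`-module `X = X^{Σ₀}`
with a group isomorphism `toDual : X ≅ Hom(Sel^{Σ₀}_E(K_∞)_p, ℚ/ℤ)` under which `T` acts as
`γ - 1` and constants `c ∈ ℤ_p` act on `p^k`-torsion classes through `ℤ_p → ℤ/p^k` — VERBATIM the
tree's `WeierstrassCurve.SelmerDualData W κ γ` (file `IwasawaSelmer`) with `W.selmerInfty κ`
replaced by `nonPrimitiveSelmerInfty W κ Σ₀`. This is the `Λ`-module "`Sel^{Σ₀}_E(ℚ_∞)_p^`" whose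
characteristic polynomial is GV's `f^{alg}_{E,Σ₀}(T)` and whose `λ`-invariant is `λ^{alg}_{E,Σ₀}`
(GV (6)–(7)). For `γ` a topological generator such data exist and are unique up to unique
`Λ`-isomorphism (proved in the cell's Summits files exactly as
`WeierstrassCurve.nonempty_selmerDualData_holds`, `SelmerDualData.nonempty_linearEquiv_holds`).
[cite: GreenbergVatsal2000, §1 p. 7 (display (6)) and §2 p. 17] -/
structure NonPrimitiveDualData where
  /-- The underlying type of the Iwasawa module `X^{Σ₀} = Sel^{Σ₀}_E(K_∞)_p^`. -/
  X : Type u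
  /-- `X` is an abelian group. -/
  [addCommGroup : AddCommGroup X]
  /-- `X` is a `Λ = ℤ_p⟦T⟧`-module. -/
  [module : Module (IwasawaAlgebra p) X]
  /-- `Sel^{Σ₀}_E(K_∞)_p` is stable under conjugation by `γ` (dischargeable:
  `conjH1_mem_nonPrimitiveSelmerInfty`). -/
  conj_mem : ∀ s ∈ nonPrimitiveSelmerInfty W κ S₀,
    W.conjH1 p κ.kerSubgroup γ s ∈ nonPrimitiveSelmerInfty W κ S₀
  /-- The identification of `X` with the character group `Hom(Sel^{Σ₀}, ℚ/ℤ)`. -/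
  toDual : X →+ (nonPrimitiveSelmerInfty W κ S₀ →+ AddCircle (1 : ℚ))
  /-- `toDual` is a group isomorphism. -/
  bijective : Function.Bijective toDual
  /-- `T` acts as `γ - 1`: `(T·x)(s) = x(conj_γ s) - x(s)`. -/
  toDual_T_smul : ∀ (x : X) (s : nonPrimitiveSelmerInfty W κ S₀),
    toDual ((PowerSeries.X : IwasawaAlgebra p) • x) s =
      toDual x ⟨W.conjH1 p κ.kerSubgroup γ s, conj_mem s s.2⟩ - toDual x s
  /-- Constants `c ∈ ℤ_p` act on `p^k`-torsion classes through `ℤ_p → ℤ/p^k`. -/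
  toDual_C_smul : ∀ (c : ℤ_[p]) (x : X) (s : nonPrimitiveSelmerInfty W κ S₀) (k : ℕ),
    (p ^ k) • s = 0 →
    toDual (PowerSeries.C c • x) s = (PadicInt.toZModPow k c).val • toDual x s

attribute [instance] NonPrimitiveDualData.addCommGroup NonPrimitiveDualData.module


end Dual

end Literature.NumberTheory.EllipticCurves.GreenbergVatsal2000

end
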